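import Summits.HodgeConjecture.HodgeConjecture.Theses.LimitExtension
import Literature.AlgebraicGeometry.HodgeTheory.LefschetzOneOne
import Literature.AlgebraicGeometry.HodgeTheory.HardLefschetzNFold
import Literature.AlgebraicGeometry.HodgeTheory.SupportedHodgeClassesAlgebraic
import Literature.AlgebraicGeometry.HodgeTheory.TopDegreeClasses
import Literature.AlgebraicGeometry.HodgeTheory.HodgeTypeDimension
import Literature.AlgebraicGeometry.HodgeTheory.ArapuraSurfaceFibredFourfoldsProofs
import Literature.AlgebraicGeometry.Resolution.ProjectiveResolutionProofs

/-!
# Route LimitExtension · `HodgeFourfolds` (stmt-HodgeConjecture-10866) — the fourfold milestone, reduced to the classical named facts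

The support item `HodgeFourfolds` of route `LimitExtension`:
`HodgeModels (inline) → LimitExtensionFour → HypersurfaceHodgeFour → ∀ X smooth projective of
dimension 4, HodgeConjectureFor 4 X`.

PROOF (the item's docstring, made precise on the tree's carriers), a case split on the
codimension `p` of a rational `(p,p)`-class `c ∈ H²ᵖ(X(ℂ); ℂ)`:
* `p = 0`: the tree (`hodgeConjectureFor_codim_zero`);
* `p = 1`: Lefschetz `(1,1)` — the named fact `lefschetzOneOne_rational` (Voisin I Thm. 11.30);
* `p = 3`: hard Lefschetz from codimension `1` — the named fact
  `nonempty_hardLefschetzNFold 4 X` through the tree's `mem_algebraicClasses_of_lt_of_nonempty`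
  (Voisin I Thm. 6.25; Murre 1977 Remark 1, "the `(3,3)`-conjecture is true for any fourfold");
* `p = 4`: the tree (`mem_algebraicClasses_of_degree_top`: every top-degree class is the class of
  a point); `p ≥ 5`: the tree (`IsOfHodgeType.eq_zero_pp_of_lt`: no `(p,p)`-classes above the
  dimension);
* `p = 2` (the middle degree): `LimitExtensionFour` supplies the one-parameter degeneration
  `f : W → T`, `g : X → W_{t₀}`, `B ∈ H⁴(W(ℂ); ℂ)`; `HypersurfaceHodgeFour` on the smooth
  hypersurface fibres `W_t` (`t ≠ t₀`) makes `B|_{W_t}` (rational: pull-backs of rational classes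
  are rational; of type `(2,2)` by the family) algebraic; the route's Hodge-free specialisation
  lemma `SpecialisationOfAlgebraicity` (`k = 2`) puts `(g ≫ ι_{t₀})^* B` in `N¹H⁴(X)`, hence
  `c = (c - (g ≫ ι)^*B) + (g ≫ ι)^*B ∈ N¹H⁴(X) = supportedClasses X 4 1`
  (`limitExtension_mem_supportedClasses_four_one`); finally a rational `(2,2)`-class supported on a
  divisor of a smooth projective fourfold is algebraic — the tree's
  `mem_algebraicClasses_of_mem_supportedClasses_of_isOfHodgeType` at `p = 1` (Voisin 2013 Lemma 2.1 /
  the divisor induction: Deligne Hodge III Cor. 8.2.8 `Deligne1974_ker_restrictCompl_eq_iSup_range_complexGysin`,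
  lifting of Hodge classes along Gysin surjections `Voisin2025_hodgeClass_lift_complexGysin`,
  projective Hironaka — PROVED in the tree, `Resolution.Hironaka1964_projective_holds` —, the
  support property of Gysin maps — PROVED, `gysinMap_restrictCompl_eq_zero_of_field ℂ` —, an
  orientation family with Poincaré duality — PROVED, `exists_orientationFamily_hasPoincareDuality` — and
  Lefschetz `(1,1)` on the resolved components of the divisor).

STATUS: CONDITIONAL. The theorem `hodgeFourfolds_of` proves the route decl from five hypotheses
that are NOT dischargeable in the tree today: the four classical named facts
`lefschetzOneOne_rational`, `nonempty_hardLefschetzNFold 4 ·`,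
`Deligne1974_ker_restrictCompl_eq_iSup_range_complexGysin`, `Voisin2025_hodgeClass_lift_complexGysin`
and the route's own open support item `SpecialisationOfAlgebraicity` (stmt-HodgeConjecture-2998).
Everything else is discharged. (In the tree `hV` is further reduced to the polarizability
`smoothProjective_hodgeStructure_isPolarizable` by `Voisin2025_hodgeClass_lift_complexGysin_holds_of`,
`hD` to Hodge III Prop. 8.2.7 `Deligne1974_ker_pullback_eq_ker_pullback_resolution` by
`Deligne1974_ker_restrictCompl_eq_iSup_range_complexGysin_holds_of`, and `hL` to GAGA for line
bundles by `lefschetzOneOne_rational_of_serreGAGA`.)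
-/

noncomputable section

open CategoryTheory
open Literature.AlgebraicGeometry Literature.AlgebraicGeometry.Motives
open Literature.AlgebraicGeometry.HodgeTheory
open Literature.AlgebraicTopology.SingularHomology

namespace Summit.HodgeConjecture.HodgeConjecture.Theorems

/-- **Middle degree, step 1 (divisor support from the limit extension).** Granted the route's
Hodge-free specialisation lemma `SpecialisationOfAlgebraicity`, the cruxes `LimitExtensionFour`
and `HypersurfaceHodgeFour` put every rational `(2,2)`-class `c` of a smooth projective fourfold in
`N¹H⁴(X(ℂ); ℂ) = supportedClasses X 4 1`: take the degeneration `(T, W, f, t₀, g, B)` of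
`LimitExtensionFour`; on each smooth hypersurface fibre `W_t`, `t ≠ t₀`, the restriction of the
rational class `B` is rational (`IsRationalClass.pullback`) and of type `(2,2)`, hence algebraic by
`HypersurfaceHodgeFour`; `SpecialisationOfAlgebraicity` (`k = 2`) gives `(g ≫ ι_{t₀})^*B ∈ N¹`, and
`c = (c - (g ≫ ι_{t₀})^*B) + (g ≫ ι_{t₀})^*B`. [cite: Thomas2005Nodes, Prop. 2]
[cite: Fulton1998, §10.1 and §20.3] -/
theorem limitExtension_mem_supportedClasses_four_one
    (hS : Theses.LimitExtension.SpecialisationOfAlgebraicity)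
    (hLE : Theses.LimitExtension.LimitExtensionFour)
    (hH : Theses.LimitExtension.HypersurfaceHodgeFour)
    {X : SchemeOver ℂ} (hX : IsSmoothProjective 4 X) (c : complexBetti X 4)
    (hc : IsRationalClass c) (h22 : IsOfHodgeType 4 X 4 2 2 c) :
    c ∈ supportedClasses X 4 1 := by
  obtain ⟨T, W, f, t₀, g, B, hT, hirr, hflat, hprop, hU, hB, hfib, hdiff⟩ := hLE hX c hc h22
  have hpull : complexBetti.map (g ≫ fiberι f t₀) 4 B ∈ supportedClasses X 4 1 := by
    refine hS (k := 2) f t₀ g B two_pos hX hT hirr hflat hprop hU fun t ht ↦ ?_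
    obtain ⟨⟨d, hd⟩, htype⟩ := hfib t ht
    exact ⟨hd.1, (hH hd).2 2 _ (hB.pullback _) htype⟩
  have h := Submodule.add_mem _ hdiff hpull
  rwa [sub_add_cancel] at h

/-- **`HodgeFourfolds` (stmt-HodgeConjecture-10866) from the classical named facts** — the Hodge
conjecture for ALL smooth projective fourfolds from Hodge models, `LimitExtensionFour` and
`HypersurfaceHodgeFour`, granted: Lefschetz `(1,1)` (`hL`, Voisin I Thm. 11.30), hard Lefschetz on
fourfolds (`hHL`, Voisin I Thm. 6.25), Deligne's Hodge III Cor. 8.2.8 (`hD`), the lifting of Hodge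
classes along Gysin surjections (`hV`, Voisin 2025 Cor. 2.12) and the route's specialisation lemma
(`hS`, item stmt-HodgeConjecture-2998). Codimension `0`: tree (`hodgeConjectureFor_codim_zero`);
`1`: `hL`; `2`: `limitExtension_mem_supportedClasses_four_one` then
`mem_algebraicClasses_of_mem_supportedClasses_of_isOfHodgeType` (at `p = 1`, with Hironaka, the
support property of Gysin maps and Poincaré duality discharged by the tree's theorems); `3` (the
"`(3,3)`-conjecture", the ONLY use of `hHL`): `mem_algebraicClasses_of_lt_of_nonempty` from
codimension `1`; `4`: tree (`mem_algebraicClasses_of_degree_top`, the class of a point); `≥ 5`: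
tree (`IsOfHodgeType.eq_zero_pp_of_lt`, no `(p,p)`-classes above the dimension).
[cite: Murre1977, Remark 1 (p. 230)] [cite: VoisinHodgeI2002, Thm. 6.25 and Thm. 11.30]
[cite: DeligneHodgeIII1974, Cor. 8.2.8] [cite: Voisin2025, Cor. 2.12] [cite: Thomas2005Nodes, Prop. 2] -/
theorem hodgeFourfolds_of (hL : lefschetzOneOne_rational)
    (hHL : ∀ X : SchemeOver ℂ, nonempty_hardLefschetzNFold 4 X)
    (hD : Deligne1974_ker_restrictCompl_eq_iSup_range_complexGysin)
    (hV : Voisin2025_hodgeClass_lift_complexGysin)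
    (hS : Theses.LimitExtension.SpecialisationOfAlgebraicity) :
    Theses.LimitExtension.HodgeFourfolds := by
  unfold Theses.LimitExtension.HodgeFourfolds
  intro hModels hLE hH X hX
  refine ⟨hModels hX, fun p c hc hpp ↦ ?_⟩
  rcases Nat.lt_or_ge 4 p with h4p | hp4
  · -- codimension `p ≥ 5`: no `(p,p)`-classes above the dimension, `c = 0`
    rw [hpp.eq_zero_pp_of_lt h4p]
    exact Submodule.zero_mem _
  interval_cases p
  · -- codimension `0`: `N⁰ H⁰ = H⁰`
    exact hodgeConjectureFor_codim_zero c
  · -- codimension `1`: Lefschetz `(1,1)`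
    exact hL hX c hc hpp
  · -- the middle degree `p = 2`
    obtain ⟨μ, hμ⟩ := exists_orientationFamily_hasPoincareDuality
    have hN : c ∈ supportedClasses X (2 * (1 + 1)) 1 :=
      limitExtension_mem_supportedClasses_four_one hS hLE hH hX c hc hpp
    exact mem_algebraicClasses_of_mem_supportedClasses_of_isOfHodgeType hD hV
      (gysinMap_restrictCompl_eq_zero_of_field ℂ) Resolution.Hironaka1964_projective_holds hL μ hμ
      hX 1 hN hc hpp
  · -- codimension `3` (the `(3,3)`-conjecture): hard Lefschetz from codimension `1`
    exact mem_algebraicClasses_of_lt_of_nonempty (p := 3) (hHL X) hX (by norm_num)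
      (fun a ha haa ↦ hL hX a ha haa) c hc hpp
  · -- codimension `4`: the class of a point
    exact mem_algebraicClasses_of_degree_top hX (by norm_num) c

/-- **`HodgeFourfolds` from its classical inputs as BINDERS** (named-fact-free, for a closable
restatement of the item): granted, on smooth projective fourfolds, (i) Lefschetz `(1,1)` (`hLef`,
the shape of the binder of `EndoscopicMiddleDegree.FourfoldHodge`; Voisin I Thm. 11.30), (ii) the
hard-Lefschetz REDUCTION for `4 < 2p` — the Hodge conjecture in codimension `4 - p` gives it in
codimension `p` (`hRed`, verbatim the binder of `EndoscopicMiddleDegree.FourfoldHodge` = the shared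
item `HardLefschetzReduction` at `n = 4`; Voisin I Thm. 6.25, Rem. 6.27; Murre 1977 Remark 1), and
(iii) the divisor descent in the middle degree — a rational `(2,2)`-class supported on a divisor is
algebraic (`hDiv`, the conclusion of the shared item `DivisorInduction` at `(n+1, p) = (4, 2)`;
Deligne Hodge III Cor. 8.2.8 + semisimplicity + Lefschetz `(1,1)` on the resolved divisor), and the
route's specialisation lemma `hS`, the cruxes `LimitExtensionFour` and `HypersurfaceHodgeFour` give
the Hodge conjecture for every smooth projective fourfold. Pure bookkeeping over
`limitExtension_mem_supportedClasses_four_one`. On the tree's named facts the three binders are,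
respectively, `lefschetzOneOne_rational`, `mem_algebraicClasses_of_lt_of_nonempty` fed
`nonempty_hardLefschetzNFold 4 X`, and `mem_algebraicClasses_of_mem_supportedClasses_of_isOfHodgeType`
at `p = 1` (see `hodgeFourfolds_of`). [cite: Murre1977, Remark 1 (p. 230)]
[cite: VoisinHodgeI2002, Thm. 6.25, Rem. 6.27 and Thm. 11.30] [cite: DeligneHodgeIII1974, Cor. 8.2.8]
[cite: Thomas2005Nodes, Prop. 2] -/
theorem hodgeFourfolds_of_binders
    (hLef : ∀ X : SchemeOver ℂ, IsSmoothProjective 4 X → ∀ c : complexBetti X (2 * 1),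
      IsRationalClass c → IsOfHodgeType 4 X (2 * 1) 1 1 c → c ∈ algebraicClasses X 1)
    (hRed : ∀ X : SchemeOver ℂ, IsSmoothProjective 4 X → ∀ p : ℕ, 4 < 2 * p →
      (∀ a : complexBetti X (2 * (4 - p)), IsRationalClass a →
        IsOfHodgeType 4 X (2 * (4 - p)) (4 - p) (4 - p) a → a ∈ algebraicClasses X (4 - p)) →
      ∀ c : complexBetti X (2 * p), IsRationalClass c → IsOfHodgeType 4 X (2 * p) p p c →
        c ∈ algebraicClasses X p)
    (hDiv : ∀ X : SchemeOver ℂ, IsSmoothProjective 4 X → ∀ c : complexBetti X (2 * 2),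
      IsRationalClass c → IsOfHodgeType 4 X (2 * 2) 2 2 c → c ∈ supportedClasses X (2 * 2) 1 →
        c ∈ algebraicClasses X 2)
    (hS : Theses.LimitExtension.SpecialisationOfAlgebraicity) :
    Theses.LimitExtension.HodgeFourfolds := by
  unfold Theses.LimitExtension.HodgeFourfolds
  intro hModels hLE hH X hX
  refine ⟨hModels hX, fun p c hc hpp ↦ ?_⟩
  -- codimension `q ≤ 1`: the tree (`q = 0`) and Lefschetz `(1,1)` (`q = 1`)
  have low : ∀ q, q ≤ 1 → ∀ a : complexBetti X (2 * q), IsRationalClass a →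
      IsOfHodgeType 4 X (2 * q) q q a → a ∈ algebraicClasses X q := by
    intro q hq a ha haa
    rcases q with _ | _ | q
    · exact hodgeConjectureFor_codim_zero a
    · exact hLef X hX a ha haa
    · omega
  rcases Nat.lt_or_ge 2 p with hp | hp
  · -- codimension `p ≥ 3`: the hard-Lefschetz reduction from codimension `4 - p ≤ 1`
    exact hRed X hX p (by omega) (low (4 - p) (by omega)) c hc hpp
  rcases Nat.lt_or_ge 1 p with hp1 | hp1
  · -- the middle degree `p = 2`: limit extension ⟹ `N¹H⁴`, then the divisor descent
    obtain rfl : p = 2 := le_antisymm hp hp1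
    exact hDiv X hX c hc hpp (limitExtension_mem_supportedClasses_four_one hS hLE hH hX c hc hpp)
  · -- codimension `≤ 1`
    exact low p hp1 c hc hpp

end Summit.HodgeConjecture.HodgeConjecture.Theorems

end
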